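import Literature.NumberTheory.GaloisRepresentations.WeilLAdicCharacterDeRhamReduction
import Literature.NumberTheory.GaloisRepresentations.DeRhamLAdicCharacterHecke
import Literature.NumberTheory.GaloisRepresentations.LAdicCharacterUnramifiedAEProofs
import HarnessLib

/-!
# A de Rham `ℓ`-adic character comes from an algebraic Hecke character — reduced to Tate's local theorem

Topic `NumberTheory/GaloisRepresentations`; namespace `Literature.NumberTheory.GaloisRepresentations`.
Proof file (theorems only; no definition, no named fact, no instance, D-0026) towards the named fact
`FramedGaloisRep.exists_heckeCharacter_of_isDeRhamFramed` (`DeRhamLAdicCharacterHecke`; Patrikis 2019,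
Prop. 2.2.1; Serre 1968, Ch. III §2.3 with App. A): a continuous `ψ : Γ_K → GL₁(ℚ̄_ℓ)` that is de Rham at
every `v ∣ ℓ` for Fontaine's pinned datum comes from an algebraic Hecke character.

## Main result

`FramedGaloisRep.exists_heckeCharacter_of_isDeRhamFramed_of_local hloc :
  FramedGaloisRep.exists_heckeCharacter_of_isDeRhamFramed` — the GLOBAL statement follows from the one
LOCAL input of the printed proof, Tate's theorem on Hodge–Tate characters of a `p`-adic field
(Serre 1968, Ch. III App. A6, Cor. 2 of the Theorem of Tate; Conrad 2011, App. B, Def. B.1 and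
Prop. B.4 (i): "`ψ` is locally algebraic if and only if its underlying `ℚ_p`-linear representation is
Hodge–Tate", de Rham ⇒ Hodge–Tate), in the vocabulary of the tree:

* (hloc) for every characteristic-`0` local field `F` of residue characteristic `ℓ`
  (`hF : |ℓ|_F < 1`) and every `ρ : Γ_F →ₜ* GL₁(ℚ̄_ℓ)` which is de Rham for Fontaine's datum
  `fontainePst F ℓ hF` (`PstWeilDeligneData.IsDeRhamFramed`, period ring `B_dR(F)` unconditionally,
  `fontainePst_𝔅_eq_bdRPeriodRingData`), there are an OPEN subgroup `V ≤ Fˣ`, finitely many continuous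
  embeddings `e : F → ℚ̄_ℓ` and integers `n_e` such that
  `ρ(w)₀₀ = ∏_e e(Art_F w)^{n_e}` for every `w` in the inertia subgroup of `W_F` with `Art_F w ∈ V`
  (`Art_F = canonicalArtin F`, THE local Artin map, Deligne's normalisation; the sign of the `n_e` is
  immaterial since they are existentially quantified) — i.e. `ρ ∘ Art_F` agrees near `1` with an
  algebraic character of the torus `Res_{F/ℚ_ℓ} 𝔾_m` (Conrad, Def. B.1).

The tree does NOT yet prove (hloc): it needs Sen's theorem "`ℂ`-admissible ⇒ potentially
unramified" (named facts `PAdicHodge.SenFiniteness`, `PAdicHodge.SenOperatorExistsUnique`) and the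
Hodge–Tate periods of the Lubin–Tate characters (Serre III App. A4–A5), see the module docstring of
`DeRhamLAdicCharacterHecke`; this file isolates it as the single remaining input, exactly as
`WeilLAdicCharacterDeRhamReduction` does for the converse fact `HeckeCharacter.exists_lAdic_isDeRhamFramed`.

## The assembly (Serre III §2.3 Thm. 2 ⇐ Ch. II §2.7; Böckle–Hui §2.4 (Loc-alg) ⇒ (E-SCS))

Let `Ψ : 𝕀_K →ₜ* ℚ̄_ℓˣ` be the idele class character of `ψ` with local–global compatibility at EVERY
finite place (`FramedGaloisRep.exists_idelicCharacter_localGlobal`: `Ψ(⟨Art w⟩_v) = det ψ(res_v w)⁻¹`,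
Neukirch VI (5.6)).  At `v ∣ ℓ`, (hloc) for `ρ = ψ|_{Γ_{K_v}}` gives `V_v ⊇ {u : |u - 1|_v ≤ |ϖ_v|^{m_v}}`
(`HeckeCharacter.exists_congrUnits_le_of_isOpen`: the congruence subgroups are a neighbourhood basis of
`1` in `K_vˣ`), embeddings `s_v` and exponents `n_{v,e}`; every unit is `Art w` for an inertial `w`
(`exists_inertia_canonicalArtin_eq`, clause `image_inertia` of `IsLocalArtinMap`), so for a global
`k ≡ 1 mod 𝔭_v^m` (`m = 1 + max_v m_v`), `Ψ(⟨k⟩_v) = ψ_v(w)₀₀⁻¹ = ∏_{e ∈ s_v} e(k)^{-n_{v,e}}`.  Reindexing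
along the bijection `(v, e) ↔ τ = e ∘ ι_v` between continuous local embeddings above `ℓ` and
`ℓ`-adic embeddings of `K` (`PadicEmbedding.placeEmbEquiv`, Serre II §3.1) gives
`∏_{v ∣ ℓ} Ψ(⟨k⟩_v) = ∏_τ τ(k)^{-n_τ}` — the idelic local algebraicity `hLA` of the PROVED Hecke-avatar
theorem `exists_heckeCharacter_of_isLocAlgAt` (Serre III §2.3 Thm. 2), which with the almost-everywhere
unramifiedness of rank-one characters (`eventually_isUnramifiedAt_of_rank_one`) yields the algebraic
Hecke character `χ` with `ψ(Frob_v) = ι⁻¹(χ(ϖ_v))⁻¹` almost everywhere.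

## References

* [Patrikis2019] S. Patrikis, *Variations on a theorem of Tate*, Mem. AMS 1238 (2019) = arXiv:1207.6724,
  §2.2, Prop. 2.2.1 (statement; "well-known, a combination of work of Serre, Henniart, and Waldschmidt").
* [SerreAbelianLadic1968] J.-P. Serre, *Abelian ℓ-adic representations and elliptic curves* (1968),
  Ch. II §2.7, §3.1; Ch. III §1.1, §2.3 (Thm. 2), App. A6 (Cor. 2: Hodge–Tate ⇔ locally algebraic).
* [Conrad2011LiftingGlobal] B. Conrad, *Lifting global representations with local properties* (2011),
  App. B, Def. B.1, Prop. B.4.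
* [BockleHui2025] G. Böckle, C.-Y. Hui, Math. Ann. 393 (2025), §2.3–2.4.
* [NeukirchANT1999] J. Neukirch, *Algebraic Number Theory* (1999), Ch. VI §5, Prop. (5.6).
* [SerreLocalFields1979] J.-P. Serre, *Local Fields* (1979), Ch. XIII §4, Thm. 1 (`Art(I_F) = 𝒪_Fˣ`).
-/

noncomputable section

open scoped NumberField Topology Polynomial
open NumberField IsDedekindDomain IsDedekindDomain.HeightOneSpectrum Filter Field Polynomial

namespace Literature.NumberTheory.GaloisRepresentations

variable {K : Type} [Field K] [NumberField K] {ℓ : ℕ} [Fact ℓ.Prime]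

/-! ### §1. The congruence subgroups `V_{v,m}` are a neighbourhood basis of `1` in `K_vˣ` -/

namespace HeckeCharacter

/-- `V_{v,m'} ≤ V_{v,m}` for `m ≤ m'`. [folklore] -/
theorem congrUnits_antitone (v : HeightOneSpectrum (𝓞 K)) {m m' : ℕ} (h : m ≤ m') :
    congrUnits v m' ≤ congrUnits v m := fun _ hu =>
  ⟨hu.1, hu.2.trans (WithZero.exp_le_exp.mpr (by omega))⟩

/-- A global `k ≡ 1 mod 𝔭_v^m` with `m ≥ 1` lies in `V_{v,m}` (its valuation is then `1`). [folklore] -/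
theorem globalToLocalUnits_mem_congrUnits {v : HeightOneSpectrum (𝓞 K)} {m : ℕ} (hm : 0 < m) {k : Kˣ}
    (hk : Valued.v (algebraMap K (v.adicCompletion K) (k : K) - 1) ≤ WithZero.exp (-(m : ℤ))) :
    globalToLocalUnits v k ∈ congrUnits v m := by
  rw [mem_congrUnits_iff, val_globalToLocalUnits]
  exact ⟨valued_eq_one_of_valued_sub_one_lt_one (hk.trans_lt (withZero_exp_neg_lt_one hm)), hk⟩

/-- **Every open subgroup of `K_vˣ` contains some `V_{v,m}`**: the congruence subgroups form a
neighbourhood basis of `1` (the unit topology is induced by `K_vˣ ↪ K_v`, whose topology is the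
valuation topology; Cassels–Fröhlich VI §3.8, "since `M` is open, there exists `n ≥ 1` such that
`U_K^n ⊆ M`"). [cite: SerreLocalFields1979, Ch. XIII §4 Thm. 1] -/
theorem exists_congrUnits_le_of_isOpen (v : HeightOneSpectrum (𝓞 K))
    {V : Subgroup (v.adicCompletion K)ˣ} (hV : IsOpen (V : Set (v.adicCompletion K)ˣ)) :
    ∃ m : ℕ, congrUnits v m ≤ V := by
  have h1 : (V : Set (v.adicCompletion K)ˣ) ∈ 𝓝 (1 : (v.adicCompletion K)ˣ) := hV.mem_nhds V.one_mem
  rw [Units.isEmbedding_val₀.nhds_eq_comap, Filter.mem_comap] at h1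
  obtain ⟨t, ht, htV⟩ := h1
  rw [Units.val_one, IsValuativeTopology.mem_nhds_iff] at ht
  obtain ⟨γ, hγ⟩ := ht
  obtain ⟨x, hx⟩ := ValuativeRel.valuation_surjective (γ : ValuativeRel.ValueGroupWithZero (v.adicCompletion K))
  have hx0 : x ≠ 0 := by
    rintro rfl
    rw [map_zero] at hx
    exact γ.ne_zero hx.symm
  have hvx0 : (Valued.v x : WithZero (Multiplicative ℤ)) ≠ 0 := (Valuation.ne_zero_iff _).mpr hx0
  -- `|x|_v = exp z`; take `m` with `exp (-m) < exp z`
  obtain ⟨m, hm⟩ : ∃ m : ℕ, WithZero.exp (-(m : ℤ)) < Valued.v x := by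
    refine ⟨(-WithZero.log (Valued.v x)).toNat + 1, ?_⟩
    conv_rhs => rw [← WithZero.exp_log hvx0]
    rw [WithZero.exp_lt_exp]
    have := Int.self_le_toNat (-WithZero.log (Valued.v x))
    push_cast
    omega
  refine ⟨m, fun u hu => htV ?_⟩
  rw [Set.mem_preimage]
  apply hγ
  refine ⟨(u : v.adicCompletion K) - 1, ?_, by simp⟩
  rw [Set.mem_setOf_eq, ← hx,
    (ValuativeRel.isEquiv (ValuativeRel.valuation (v.adicCompletion K))
      (Valued.v : Valuation (v.adicCompletion K) (WithZero (Multiplicative ℤ)))).lt_iff_lt]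
  exact hu.2.trans_lt hm

end HeckeCharacter

/-! ### §2. Units are Artin images of inertia; the idelic avatar on them -/

/-- The two valuations of `K_v` agree on "`= 1`" (they are equivalent: the valuative relation of
`K_v` is defined from `Valued.v`). [folklore] -/
theorem valuation_adicCompletion_eq_one_iff (v : HeightOneSpectrum (𝓞 K)) (x : v.adicCompletion K) :
    ValuativeRel.valuation (v.adicCompletion K) x = 1 ↔ Valued.v x = 1 :=
  (ValuativeRel.isEquiv (ValuativeRel.valuation (v.adicCompletion K))
    (Valued.v : Valuation (v.adicCompletion K) (WithZero (Multiplicative ℤ)))).eq_one_iff_eq_one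

/-- **`𝒪_vˣ = Art(I_v)`**: a unit of `K_v` of valuation one is `Art w` for some `w` in the inertia
subgroup of `W_{K_v}` (clause `image_inertia` of THE local Artin map `canonicalArtin K_v`,
`isLocalArtinMap_canonicalArtin_holds`). [cite: SerreLocalFields1979, Ch. XIII §4 Thm. 1] -/
theorem exists_inertia_canonicalArtin_eq (v : HeightOneSpectrum (𝓞 K)) {u : (v.adicCompletion K)ˣ}
    (hu : Valued.v (u : v.adicCompletion K) = 1) :
    ∃ w ∈ WeilGroup.inertia (v.adicCompletion K), canonicalArtin (v.adicCompletion K) w = u := by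
  have hmem : u ∈ (ValuativeRel.valuation (v.adicCompletion K)).valuationSubring.unitGroup := by
    rw [Valuation.mem_unitGroup_iff, valuation_adicCompletion_eq_one_iff]
    exact hu
  rw [← (isLocalArtinMap_canonicalArtin_holds (v.adicCompletion K)).image_inertia, Subgroup.mem_map] at hmem
  exact hmem

/-- **The idelic avatar on `𝒪_vˣ` reads the local character through THE Artin map**: if `Ψ` has the
local–global compatibility of `FramedGaloisRep.exists_idelicCharacter_localGlobal`, then
`Ψ(⟨Art w⟩_v) = (ψ|_{Γ_{K_v}}(w)₀₀)⁻¹` for every `w ∈ W_{K_v}`.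
[cite: NeukirchANT1999, Ch. VI §5 Prop. (5.6)] [cite: SerreAbelianLadic1968, Ch. III §2.3] -/
theorem coe_idelic_localUnits_canonicalArtin {ψ : FramedGaloisRep K (PadicAlgCl ℓ) 1}
    {Ψ : ideleGroup K →ₜ* (PadicAlgCl ℓ)ˣ}
    (hLG : ∀ (v : HeightOneSpectrum (𝓞 K)) (a : WeilGroup (v.adicCompletion K) →* (v.adicCompletion K)ˣ),
      IsLocalArtinMap (v.adicCompletion K) a → ∀ w : WeilGroup (v.adicCompletion K),
        Ψ (localUnits v (a w)) =
          (FramedRep.det ψ (absGaloisRestrict K (v.adicCompletion K)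
            (WeilGroup.toAbsGalois (v.adicCompletion K) w)))⁻¹)
    (v : HeightOneSpectrum (𝓞 K)) (w : WeilGroup (v.adicCompletion K)) :
    ((Ψ (localUnits v (canonicalArtin (v.adicCompletion K) w)) : (PadicAlgCl ℓ)ˣ) : PadicAlgCl ℓ) =
      ((((ψ.toLocal v) (WeilGroup.toAbsGalois (v.adicCompletion K) w) : GL (Fin 1) (PadicAlgCl ℓ)) :
        Matrix (Fin 1) (Fin 1) (PadicAlgCl ℓ)) 0 0)⁻¹ := by
  rw [hLG v _ (isLocalArtinMap_canonicalArtin_holds (v.adicCompletion K)) w, Units.val_inv_eq_inv_val,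
    FramedGaloisRep.coe_det_apply_of_rank_one, FramedGaloisRep.toLocal_apply]

/-! ### §3. Reindexing: finsets of embeddings, local embeddings above `ℓ`, `ℓ`-adic embeddings -/

/-- A product over a finset `s` of CONTINUOUS embeddings `K_v → ℚ̄_ℓ` is the product over all continuous
embeddings of the same factors, with exponent `0` (factor `1`) off `s`. [folklore] -/
theorem prod_zpow_neg_eq_prod_subtype {v : HeightOneSpectrum (𝓞 K)}
    (s : Finset (v.adicCompletion K →+* PadicAlgCl ℓ)) (hs : ∀ e ∈ s, Continuous e)
    (nl N' : (v.adicCompletion K →+* PadicAlgCl ℓ) → ℤ) (hN : ∀ e ∈ s, N' e = nl e)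
    (hN0 : ∀ e : v.adicCompletion K →+* PadicAlgCl ℓ, Continuous e → e ∉ s → N' e = 0)
    (a : v.adicCompletion K) :
    ∏ e ∈ s, e a ^ (-(nl e)) =
      ∏ eh : {e : v.adicCompletion K →+* PadicAlgCl ℓ // Continuous e}, eh.1 a ^ (-(N' eh.1)) := by
  classical
  set T : Finset (v.adicCompletion K →+* PadicAlgCl ℓ) :=
    (Finset.univ : Finset {e : v.adicCompletion K →+* PadicAlgCl ℓ // Continuous e}).map
      (Function.Embedding.subtype _) with hT
  have hmemT : ∀ e, e ∈ T ↔ Continuous e := fun e => by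
    constructor
    · intro he
      obtain ⟨eh, -, rfl⟩ := Finset.mem_map.mp he
      exact eh.2
    · intro he
      exact Finset.mem_map.mpr ⟨⟨e, he⟩, Finset.mem_univ _, rfl⟩
  rw [← Finset.prod_subtype T hmemT (fun e => e a ^ (-(N' e)))]
  rw [← Finset.prod_subset (fun e he => (hmemT e).mpr (hs e he)) (fun e heT hes => by
    rw [hN0 e ((hmemT e).mp heT) hes, neg_zero, zpow_zero])]
  exact Finset.prod_congr rfl fun e he => by rw [hN e he]

/-- **A product over the local embeddings above `ℓ` is an iterated product over the places above `ℓ`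
and the continuous embeddings of their completions** (`PlaceEmb K ℓ` is the sigma type).
[cite: SerreAbelianLadic1968, Ch. II §3.1] -/
theorem PadicEmbedding.prod_placeEmb_eq_prod_prod {M : Type*} [CommMonoid M]
    [Fintype {v : HeightOneSpectrum (𝓞 K) // ((ℓ : ℕ) : 𝓞 K) ∈ v.asIdeal}] (f : PlaceEmb K ℓ → M) :
    ∏ p : PlaceEmb K ℓ, f p =
      ∏ vh : {v : HeightOneSpectrum (𝓞 K) // ((ℓ : ℕ) : 𝓞 K) ∈ v.asIdeal},
        ∏ eh : {e : vh.1.adicCompletion K →+* PadicAlgCl ℓ // Continuous e}, f ⟨vh, eh⟩ := by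
  classical
  rw [← Finset.prod_sigma Finset.univ (fun _ => Finset.univ) f]
  refine Finset.prod_congr ?_ fun _ _ => rfl
  apply Finset.ext
  rintro ⟨vh, eh⟩
  exact ⟨fun _ => Finset.mem_sigma.mpr ⟨Finset.mem_univ _, Finset.mem_univ _⟩, fun _ => Finset.mem_univ _⟩

/-! ### §4. The theorem: Serre III §2.3, assembled from Tate's local theorem -/

/-- **A de Rham `ℓ`-adic character is the `ℓ`-adic avatar of an algebraic Hecke character, granted
Tate's local theorem** (Patrikis 2019, Prop. 2.2.1; Serre 1968, Ch. III §2.3 Thm. 2 with App. A6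
Cor. 2; Conrad 2011, App. B, Def. B.1 and Prop. B.4).  Suppose (hloc): for every characteristic-`0`
local field `F` of residue characteristic `ℓ` and every `ρ : Γ_F →ₜ* GL₁(ℚ̄_ℓ)` de Rham for Fontaine's
datum `fontainePst F ℓ hF` there are an open subgroup `V ≤ Fˣ`, finitely many continuous embeddings
`e : F → ℚ̄_ℓ` and integers `n_e` with `ρ(w)₀₀ = ∏_e e(Art_F w)^{n_e}` for every inertial `w ∈ W_F` with
`Art_F w ∈ V` ("`ρ ∘ Art_F` is algebraic near `1`": a Hodge–Tate — in particular a de Rham — character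
of a `p`-adic field is locally algebraic).  Then `FramedGaloisRep.exists_heckeCharacter_of_isDeRhamFramed`
holds: for `ψ : Γ_K →ₜ* GL₁(ℚ̄_ℓ)` de Rham at every `v ∣ ℓ` and `ι : ℚ̄_ℓ ≃ ℂ`, the idele class character
`Ψ = ψ ∘ Art_K` (`exists_idelicCharacter_localGlobal`) satisfies `∏_{v ∣ ℓ} Ψ(⟨k⟩_v) = ∏_τ τ(k)^{-n_τ}` for
`k ≡ 1 mod 𝔭_v^m` (`v ∣ ℓ`), `n_{e ∘ ι_v} = n_{v,e}` (reindexing `PadicEmbedding.placeEmbEquiv`), and the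
Hecke avatar `exists_heckeCharacter_of_isLocAlgAt` (Serre III §2.3 Thm. 2) produces the algebraic `χ`.
[cite: SerreAbelianLadic1968, Ch. III §2.3 Thm. 2 and App. A6 Cor. 2]
[cite: Conrad2011LiftingGlobal, App. B, Def. B.1 and Prop. B.4] [cite: Patrikis2019, Prop. 2.2.1] -/
theorem FramedGaloisRep.exists_heckeCharacter_of_isDeRhamFramed_of_local
    (hloc : ∀ (F : Type) [Field F] [ValuativeRel F] [TopologicalSpace F] [IsNonarchimedeanLocalField F]
      [CharZero F] (ℓ : ℕ) [Fact ℓ.Prime] (hF : ValuativeRel.valuation F (ℓ : F) < 1)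
      (ρ : FramedRep (absoluteGaloisGroup F) (PadicAlgCl ℓ) 1),
      (Literature.NumberTheory.PAdicHodge.fontainePst F ℓ hF).IsDeRhamFramed ρ →
        ∃ V : Subgroup Fˣ, IsOpen (V : Set Fˣ) ∧
          ∃ (s : Finset (F →+* PadicAlgCl ℓ)) (n : (F →+* PadicAlgCl ℓ) → ℤ), (∀ e ∈ s, Continuous e) ∧
            ∀ w ∈ WeilGroup.inertia F, canonicalArtin F w ∈ V →
              ((ρ (WeilGroup.toAbsGalois F w) : GL (Fin 1) (PadicAlgCl ℓ)) :
                  Matrix (Fin 1) (Fin 1) (PadicAlgCl ℓ)) 0 0 =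
                ∏ e ∈ s, e ((canonicalArtin F w : Fˣ) : F) ^ n e) :
    FramedGaloisRep.exists_heckeCharacter_of_isDeRhamFramed := by
  intro K _ _ ℓ _ ψ hdR ι
  classical
  -- Step 0: Tate's theorem at every `v ∣ ℓ`, with the open subgroup shrunk to a congruence subgroup
  have hloc' : ∀ (v : HeightOneSpectrum (𝓞 K)) (hv : ((ℓ : ℕ) : 𝓞 K) ∈ v.asIdeal),
      ∃ (m : ℕ) (s : Finset (v.adicCompletion K →+* PadicAlgCl ℓ))
        (n : (v.adicCompletion K →+* PadicAlgCl ℓ) → ℤ), (∀ e ∈ s, Continuous e) ∧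
        ∀ w ∈ WeilGroup.inertia (v.adicCompletion K),
          canonicalArtin (v.adicCompletion K) w ∈ HeckeCharacter.congrUnits v m →
            (((ψ.toLocal v) (WeilGroup.toAbsGalois (v.adicCompletion K) w) : GL (Fin 1) (PadicAlgCl ℓ)) :
                Matrix (Fin 1) (Fin 1) (PadicAlgCl ℓ)) 0 0 =
              ∏ e ∈ s, e ((canonicalArtin (v.adicCompletion K) w : (v.adicCompletion K)ˣ) :
                v.adicCompletion K) ^ n e := by
    intro v hv
    haveI := LocalField.charZero_adicCompletion v
    have hF := LocalField.valuation_adicCompletion_natCast_lt_one v ℓ hv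
    have hdRv : (Literature.NumberTheory.PAdicHodge.fontainePst (v.adicCompletion K) ℓ hF).IsDeRhamFramed
        (ψ.toLocal v) := hdR v hv
    obtain ⟨V, hVo, s, n, hs, hV⟩ := hloc (v.adicCompletion K) ℓ hF (ψ.toLocal v) hdRv
    obtain ⟨m, hm⟩ := HeckeCharacter.exists_congrUnits_le_of_isOpen v hVo
    exact ⟨m, s, n, hs, fun w hw hwm => hV w hw (hm hwm)⟩
  choose m s nloc hs hloc'' using hloc'
  -- Step 1: the idele class character of `ψ`, with local–global compatibility at every place
  obtain ⟨Ψ, hK, hunr, hLG⟩ := ψ.exists_idelicCharacter_localGlobal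
  -- Step 2: the places above `ℓ`, the level and the exponents
  have hfin : {v : HeightOneSpectrum (𝓞 K) | ((ℓ : ℕ) : 𝓞 K) ∈ v.asIdeal}.Finite := by
    have hI : Ideal.span {((ℓ : ℕ) : 𝓞 K)} ≠ ⊥ := by
      rw [Ne, Ideal.span_singleton_eq_bot]
      exact_mod_cast (Fact.out : ℓ.Prime).ne_zero
    refine (Ideal.finite_factors hI).subset fun v hv => ?_
    simp only [Set.mem_setOf_eq] at hv ⊢
    exact (Ideal.dvd_span_singleton).mpr hv
  haveI : Fintype {v : HeightOneSpectrum (𝓞 K) // ((ℓ : ℕ) : 𝓞 K) ∈ v.asIdeal} :=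
    Fintype.subtype hfin.toFinset fun v => by rw [Set.Finite.mem_toFinset, Set.mem_setOf_eq]
  set L : Finset (HeightOneSpectrum (𝓞 K)) := hfin.toFinset with hLdef
  have hLiff : ∀ v, v ∈ L ↔ ((ℓ : ℕ) : 𝓞 K) ∈ v.asIdeal := fun v => by
    rw [hLdef, Set.Finite.mem_toFinset, Set.mem_setOf_eq]
  have hL : ∀ v : HeightOneSpectrum (𝓞 K), ((ℓ : ℕ) : 𝓞 K) ∈ v.asIdeal → v ∈ L := fun v hv =>
    (hLiff v).mpr hv
  -- the level `M = 1 + max_v m_v`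
  set M : ℕ := (Finset.univ.sup fun vh : {v : HeightOneSpectrum (𝓞 K) // ((ℓ : ℕ) : 𝓞 K) ∈ v.asIdeal} =>
    m vh.1 vh.2) + 1 with hMdef
  have hMpos : 0 < M := Nat.succ_pos _
  have hmM : ∀ v hv, m v hv ≤ M := fun v hv =>
    (Finset.le_sup (f := fun vh : {v : HeightOneSpectrum (𝓞 K) // ((ℓ : ℕ) : 𝓞 K) ∈ v.asIdeal} =>
      m vh.1 vh.2) (Finset.mem_univ ⟨v, hv⟩)).trans (Nat.le_succ _)
  -- the exponents, on local embeddings and on `ℓ`-adic embeddings of `K`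
  set N : PadicEmbedding.PlaceEmb K ℓ → ℤ := fun p =>
    if p.2.1 ∈ s p.1.1 p.1.2 then nloc p.1.1 p.1.2 p.2.1 else 0 with hNdef
  set n : (K →+* PadicAlgCl ℓ) → ℤ := fun τ => N ((PadicEmbedding.placeEmbEquiv K ℓ).symm τ) with hndef
  -- Step 3: `Ψ` is locally algebraic at `L` with exponents `n` and level `M`
  have hLA : ∀ k : Kˣ, (∀ v ∈ L, Valued.v (algebraMap K (v.adicCompletion K) (k : K) - 1) ≤
        WithZero.exp (-(M : ℤ))) →
      (∏ v ∈ L, ((Ψ (localUnits v (globalToLocalUnits v k)) : (PadicAlgCl ℓ)ˣ) : PadicAlgCl ℓ)) =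
        ∏ τ : K →+* PadicAlgCl ℓ, τ (k : K) ^ (-(n τ)) := by
    intro k hk
    -- at one place `v ∣ ℓ`: `Ψ(⟨k⟩_v) = ψ_v(w)₀₀⁻¹ = ∏_{e ∈ s_v} e(k)^{-n_{v,e}}` for `Art w = k`
    have hplace : ∀ (v : HeightOneSpectrum (𝓞 K)) (hv : ((ℓ : ℕ) : 𝓞 K) ∈ v.asIdeal),
        ((Ψ (localUnits v (globalToLocalUnits v k)) : (PadicAlgCl ℓ)ˣ) : PadicAlgCl ℓ) =
          ∏ e ∈ s v hv, e (algebraMap K (v.adicCompletion K) (k : K)) ^ (-(nloc v hv e)) := by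
      intro v hv
      have hkv : globalToLocalUnits v k ∈ HeckeCharacter.congrUnits v (m v hv) :=
        HeckeCharacter.congrUnits_antitone v (hmM v hv)
          (HeckeCharacter.globalToLocalUnits_mem_congrUnits hMpos (hk v (hL v hv)))
      obtain ⟨w, hwI, hw⟩ := exists_inertia_canonicalArtin_eq v hkv.1
      have hart : canonicalArtin (v.adicCompletion K) w ∈ HeckeCharacter.congrUnits v (m v hv) := by
        rw [hw]; exact hkv
      rw [← hw, coe_idelic_localUnits_canonicalArtin hLG v w, hloc'' v hv w hwI hart,
        ← Finset.prod_inv_distrib]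
      refine Finset.prod_congr rfl fun e _ => ?_
      rw [zpow_neg, hw, val_globalToLocalUnits]
    calc (∏ v ∈ L, ((Ψ (localUnits v (globalToLocalUnits v k)) : (PadicAlgCl ℓ)ˣ) : PadicAlgCl ℓ))
        = ∏ vh : {v : HeightOneSpectrum (𝓞 K) // ((ℓ : ℕ) : 𝓞 K) ∈ v.asIdeal},
            ((Ψ (localUnits vh.1 (globalToLocalUnits vh.1 k)) : (PadicAlgCl ℓ)ˣ) : PadicAlgCl ℓ) :=
          Finset.prod_subtype L hLiff _
      _ = ∏ vh : {v : HeightOneSpectrum (𝓞 K) // ((ℓ : ℕ) : 𝓞 K) ∈ v.asIdeal},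
            ∏ e ∈ s vh.1 vh.2, e (algebraMap K (vh.1.adicCompletion K) (k : K)) ^ (-(nloc vh.1 vh.2 e)) :=
          Fintype.prod_congr _ _ fun vh => hplace vh.1 vh.2
      _ = ∏ vh : {v : HeightOneSpectrum (𝓞 K) // ((ℓ : ℕ) : 𝓞 K) ∈ v.asIdeal},
            ∏ eh : {e : vh.1.adicCompletion K →+* PadicAlgCl ℓ // Continuous e},
              eh.1 (algebraMap K (vh.1.adicCompletion K) (k : K)) ^
                (-(if eh.1 ∈ s vh.1 vh.2 then nloc vh.1 vh.2 eh.1 else 0)) :=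
          Fintype.prod_congr _ _ fun vh => prod_zpow_neg_eq_prod_subtype (s vh.1 vh.2) (hs vh.1 vh.2)
            (nloc vh.1 vh.2) (fun e => if e ∈ s vh.1 vh.2 then nloc vh.1 vh.2 e else 0)
            (fun e he => if_pos he) (fun e _ he => if_neg he) _
      _ = ∏ p : PadicEmbedding.PlaceEmb K ℓ,
            p.2.1 (algebraMap K (p.1.1.adicCompletion K) (k : K)) ^ (-(N p)) :=
          (PadicEmbedding.prod_placeEmb_eq_prod_prod fun p : PadicEmbedding.PlaceEmb K ℓ =>
            p.2.1 (algebraMap K (p.1.1.adicCompletion K) (k : K)) ^ (-(N p))).symm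
      _ = ∏ τ : K →+* PadicAlgCl ℓ, τ (k : K) ^ (-(n τ)) := by
          refine Fintype.prod_equiv (PadicEmbedding.placeEmbEquiv K ℓ) _ _ fun p => ?_
          show _ = _ ^ (-(N ((PadicEmbedding.placeEmbEquiv K ℓ).symm (PadicEmbedding.placeEmbEquiv K ℓ p))))
          rw [Equiv.symm_apply_apply]
          rfl
  -- Step 4: the Hecke avatar (Serre III §2.3 Thm. 2)
  have hΨ : ∀ᶠ v : HeightOneSpectrum (𝓞 K) in cofinite, ψ.IsUnramifiedAt v ∧
      (∀ u : (v.adicCompletionIntegers K)ˣ,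
          Ψ (localUnits v (Units.map ((v.adicCompletionIntegers K).subtype : _ →* _) u)) = 1) ∧
      ∀ ϖ : (v.adicCompletion K)ˣ, Valued.v (ϖ : v.adicCompletion K) = WithZero.exp (-1 : ℤ) →
        ψ.HasFrobCharpolyAt v (X - C ((Ψ (localUnits v ϖ) : (PadicAlgCl ℓ)ˣ) : PadicAlgCl ℓ)) :=
    ψ.eventually_isUnramifiedAt_of_rank_one.mono fun v hv => ⟨hv, (hunr v hv).1, (hunr v hv).2⟩
  exact exists_heckeCharacter_of_isLocAlgAt ψ Ψ hK hΨ L hL n M hLA ι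

end Literature.NumberTheory.GaloisRepresentations

end
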